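import Summits.QuantumFields.BalabanUV.Beta.FP.KernelStepDressingRecentre

/-!
# `BalabanUV.Beta.FP.KernelStepDressingPeriodisedW` — road «FP», binder row D1, ROUTE T (β1), (H5-F box) junctions, THE ROAD's ANALYTIC PIECE (i), SECOND ORDER:
# **THE DIAGONAL AND THE TORUS PERIODISATION PASS THROUGH THE SECOND-ORDER STEP DRESSING** —
# `perF M (dper M (dressW N L w W μ y ν y′)) p q = Σ_c Σ_e Σ'_t w c μ (L•y − t) · Σ'_{t′} w e ν (L•y′ − t′) · perF M (dper M (W c t e t′)) p q`

WHY (located).  The twin of `KernelStepDressingPeriodised` (p743874 ✓, first order) that the END's second-order F-junctions `hHF₂ hQF₂` read (road g59 HANDOFF item (3);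
SPEC-64 §19 (3); an2 g81 W-4: (C1) class — each junction = (i) periodisation through the dressing superposition (analytic, road) + (ii) v10's N-side identification one storey
down + (iii) the door data's one-storey recursion (the row's)).  The members `W c t e t′` of the dressed second-order family (`KernelStepDressing.dressW`, a `VertexFamily₂` at
blocking `N`) live at TWO points `(N•t, N•t′)`, so the two superpositions are NESTED: the inner sum over `t′` is re-centred at `N•(L•y′)` in its SECOND leg
(`KernelStepDressingRecentre.abs_recentre_snd_le`), giving a family bi-localised at the common pair `(N•t, N•(L•y′))` to which p743874's two-centre engine `dper_tsum_family₂`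
and the road's `perZ_dper_tsum_family₂` apply; the inner superposition is then ONE kernel bi-localised at `(N•t, N•(L•y′))` (`biLoc_tsum_family₂`), and the outer sum over `t`
is re-centred at `N•(L•y)` in its FIRST leg (`abs_recentre_fst_le`) — the same two engines at the pair `(N•(L•y), N•(L•y′))`; the finite double sum over the column indices
`(c, e)` moves through `dper`∕`perZ` by `Summable.tsum_finsetSum` on the summands' own bi-localisation.

WHAT ([folklore] lattice-sum bookkeeping; generic dimension `d`; no `def`, no `def … : Prop`, nothing cited, 0 sorry).
* §2 the INNER superposition `cwsum N (w e ν (L•y′ − ·)) (W c t e)`: `abs_dressWInner_term_le`, `biLoc_dressWInner`, **`dper_dressWInner_apply`**, **`perZ_dper_dressWInner_apply`**.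
* §3 the OUTER superposition and the dressed family: `abs_dressWOuter_term_le`, **`dper_dressWOuter_apply`**, **`perZ_dper_dressWOuter_apply`**, `summable_translate_dressWOuter`,
  `summable_translate_dper_dressWOuter`, **`dper_dressW_apply`**, **`perZ_dper_dressW_apply`**, **`perF_dper_dressW`**.
WHAT THIS IS NOT: not the wound even half the END displays (`𝒲bF`: one more superposition over the second source's box translates + `♮` — its second centre MOVES with the winding
index, so it is NOT a common-pair family; next file, with a 2-D summability in place of `ProdBound`); not (ii)(iii); not a junction; nothing of Bałaban's asserted, valued or
discharged; 0 estimates beyond [folklore] geometric series BY NAME; 0∕4 row-D1 binders; NOT (C1), NOT (T-ID), NOT D1, NEVER «G-an2-4 closed», NOT BetaPertH, NOT continuum, NOT Clay.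
HONEST DEPENDENCY (page 1, mandatory): continuum YM on T⁴ ⇐ BetaPertH ∧ nine spine estimates (0/9 proved); BetaPertH ⇐ (D1) ∧ (D4) ∧ CAP+tail;
G-an2-4 gates asym, D1 and NE2/3/4.  HONEST FRAMING (cell contract, verbatim): «discharging `BetaPertH` makes Bałaban's UV stability UNCONDITIONAL —
a real constructive-QFT result; it is NOT the continuum limit and NOT the Clay problem.»  ABSOLUTE RULE (cell charter, verbatim): «No internally-minted
statement may enter as a cited fact. Every hypothesis is either kernel-proved in this package or a verbatim quotation of a PUBLISHED theorem with page
reference. The manuscript(s) under audit are NOT citable for their own disputed steps — they are the thing under adjudication; programme-internal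
(2001/route/tribunal) claims are never citable.»  Road «FP» OWNER, b2b-balaban-beta-d1-p3 gen 60, 2026-08-29.  No existing file touched.
-/

noncomputable section

open scoped BigOperators

namespace Summit.QuantumFields.BalabanUV.Beta.FP.KernelStepDressingPeriodisedW

open Finset
open Literature.MathematicalPhysics.QuantumFieldTheory
open Literature.MathematicalPhysics.QuantumFieldTheory.Balaban1983to89
open Literature.MathematicalPhysics.QuantumFieldTheory.Balaban1983to89.Beta
open B12Sec2to5 (l1 l1_nonneg)
open B4TorusKernel.MultiPeriod (translate)
open B4Sect5Proof (latticeConst latticeConst_nonneg)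
open ExpKernelCalculus (Site MKer BiLoc Decays VertexFamily₂ l1_natSmul l1_sub_triangle summable_exp_shift' l1_sub_symm)
open DressedMomentNormalisation (EKer)
open OneStepResolventKernel (Fib)
open InterLevelTransport (cwsum cwsum_apply)
open KernelWard (ProdBound tsum_comm_of_prodBound)
open Summit.QuantumFields.BalabanUV.Beta.FP.KernelPeriodisationFib (Idx perF perF_apply perZ perZ_apply)
open Summit.QuantumFields.BalabanUV.Beta.FP.KernelPeriodisationFibLoc (dper dper_apply summable_dper decays_dper summable_exp_l1_translate)
open Summit.QuantumFields.BalabanUV.Beta.FP.KernelStepDressing (dressW dressW_apply)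
open Summit.QuantumFields.BalabanUV.Beta.FP.KernelStepDressingHessKer (dressW_eq_sum abs_col_le)
open Summit.QuantumFields.BalabanUV.Beta.FP.KernelStepDressingPeriodised (biLoc_tsum_family₂ dper_tsum_family₂ summable_dressVWeight)
open Summit.QuantumFields.BalabanUV.Beta.FP.KernelStepDressingRecentre

variable {d : ℕ}

/-! ## §2 The INNER superposition `cwsum N (w e ν (L•y′ − ·)) (W c t e)` — bi-localised at the common pair `(N•t, N•(L•y′))` -/

section Inner

variable {N : ℕ} [NeZero N] (L : ℕ) {w : EKer (d + 1)} {Cw δw : ℝ}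
  {W : Fin (d + 1) → Site (d + 1) → Fin (d + 1) → Site (d + 1) → MKer (d + 1) (Fib d)} {C2 δ : ℝ}
  (M : Fin (d + 1) → ℕ) [∀ i, NeZero (M i)]

omit [∀ i, NeZero (M i)] in
/-- [folklore] the inner term bound: `|w e ν (L•y′ − t′) · W c t e t′ x z a b| ≤ g t′ · e^{−m(|x − N•t|₁ + |z − N•(L•y′)|₁)}` (§1, second leg). -/
theorem abs_dressWInner_term_le (hw : ∀ c a u, |w c a u| ≤ Cw * Real.exp (-δw * l1 u)) (hCw : 0 ≤ Cw) (hδw : 0 < δw)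
    (hW : VertexFamily₂ W N C2 δ) (hδ : 0 < δ) (c : Fin (d + 1)) (t : Site (d + 1)) (e ν : Fin (d + 1)) (y' t' x z : Site (d + 1)) (a b : Fib d) :
    |w e ν ((L : ℤ) • y' - t') * W c t e t' x z a b|
      ≤ (Cw * C2 * Real.exp (-(δw / 2) * l1 (t' - (L : ℤ) • y')))
          * Real.exp (-(min δ (δw / (4 * N))) * (l1 (x - (N : ℤ) • t) + l1 (z - (N : ℤ) • ((L : ℤ) • y')))) :=
  abs_recentre_snd_le L hw hCw hδw (hW c t e t') ((hW c t e t').nonneg (Sum.inl 0)) hδ e ν y' x z a b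

/-- [folklore] **the inner superposition is bi-localised at `(N•t, N•(L•y′))`** with the summed constant, rate `min δ (δw∕(4N))`. -/
theorem biLoc_dressWInner (hw : ∀ c a u, |w c a u| ≤ Cw * Real.exp (-δw * l1 u)) (hCw : 0 ≤ Cw) (hδw : 0 < δw)
    (hW : VertexFamily₂ W N C2 δ) (hδ : 0 < δ) (c : Fin (d + 1)) (t : Site (d + 1)) (e ν : Fin (d + 1)) (y' : Site (d + 1)) :
    BiLoc (cwsum N (fun t' => w e ν ((L : ℤ) • y' - t')) (W c t e)) ((N : ℤ) • t) ((N : ℤ) • ((L : ℤ) • y'))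
      (∑' t' : Site (d + 1), Cw * C2 * Real.exp (-(δw / 2) * l1 (t' - (L : ℤ) • y'))) (min δ (δw / (4 * N))) := by
  have h := biLoc_tsum_family₂ (T := fun t' : Site (d + 1) => fun x z a b => w e ν ((L : ℤ) • y' - t') * W c t e t' x z a b)
    (fun t' x z a b => abs_dressWInner_term_le L hw hCw hδw hW hδ c t e ν y' t' x z a b) (summable_dressVWeight L hδw Cw C2 y')
  intro x z a b
  rw [cwsum_apply]
  exact h x z a b

/-- [folklore] **`dper_dressWInner_apply`**: `dper M (cwsum N (w e ν (L•y′ − ·)) (W c t e)) x z a b = Σ'_{t′} w e ν (L•y′ − t′) · dper M (W c t e t′) x z a b`. -/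
theorem dper_dressWInner_apply (hw : ∀ c a u, |w c a u| ≤ Cw * Real.exp (-δw * l1 u)) (hCw : 0 ≤ Cw) (hδw : 0 < δw)
    (hW : VertexFamily₂ W N C2 δ) (hδ : 0 < δ) (c : Fin (d + 1)) (t : Site (d + 1)) (e ν : Fin (d + 1)) (y' x z : Site (d + 1)) (a b : Fib d) :
    dper M (cwsum N (fun t' => w e ν ((L : ℤ) • y' - t')) (W c t e)) x z a b
      = ∑' t' : Site (d + 1), w e ν ((L : ℤ) • y' - t') * dper M (W c t e t') x z a b := by
  have hC2 : 0 ≤ C2 := (hW c t e 0).nonneg (Sum.inl 0)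
  have hNpos : (0 : ℝ) < N := by exact_mod_cast Nat.pos_of_ne_zero (NeZero.ne N)
  have hm : 0 < min δ (δw / (4 * N)) := lt_min hδ (by positivity)
  have hform : cwsum N (fun t' => w e ν ((L : ℤ) • y' - t')) (W c t e)
      = fun x z a b => ∑' t' : Site (d + 1), (fun t' : Site (d + 1) => fun x z a b => w e ν ((L : ℤ) • y' - t') * W c t e t' x z a b) t' x z a b := by
    funext x z a b; rw [cwsum_apply]
  rw [hform, dper_tsum_family₂ M (T := fun t' : Site (d + 1) => fun x z a b => w e ν ((L : ℤ) • y' - t') * W c t e t' x z a b)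
    (fun t' x z a b => abs_dressWInner_term_le L hw hCw hδw hW hδ c t e ν y' t' x z a b) (summable_dressVWeight L hδw Cw C2 y')
    (fun t' => by positivity) hm x z a b]
  exact tsum_congr fun t' => dper_const_mul M _ _ x z a b

/-- [folklore] **`perZ_dper_dressWInner_apply`**: `perZ M (dper M (cwsum …)) x z a b = Σ'_{t′} w e ν (L•y′ − t′) · perZ M (dper M (W c t e t′)) x z a b`. -/
theorem perZ_dper_dressWInner_apply (hw : ∀ c a u, |w c a u| ≤ Cw * Real.exp (-δw * l1 u)) (hCw : 0 ≤ Cw) (hδw : 0 < δw)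
    (hW : VertexFamily₂ W N C2 δ) (hδ : 0 < δ) (c : Fin (d + 1)) (t : Site (d + 1)) (e ν : Fin (d + 1)) (y' x z : Site (d + 1)) (a b : Fib d) :
    perZ M (dper M (cwsum N (fun t' => w e ν ((L : ℤ) • y' - t')) (W c t e))) x z a b
      = ∑' t' : Site (d + 1), w e ν ((L : ℤ) • y' - t') * perZ M (dper M (W c t e t')) x z a b := by
  have hC2 : 0 ≤ C2 := (hW c t e 0).nonneg (Sum.inl 0)
  have hNpos : (0 : ℝ) < N := by exact_mod_cast Nat.pos_of_ne_zero (NeZero.ne N)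
  have hm : 0 < min δ (δw / (4 * N)) := lt_min hδ (by positivity)
  have hform : cwsum N (fun t' => w e ν ((L : ℤ) • y' - t')) (W c t e)
      = fun x z a b => ∑' t' : Site (d + 1), (fun t' : Site (d + 1) => fun x z a b => w e ν ((L : ℤ) • y' - t') * W c t e t' x z a b) t' x z a b := by
    funext x z a b; rw [cwsum_apply]
  rw [hform, perZ_dper_tsum_family₂ M (T := fun t' : Site (d + 1) => fun x z a b => w e ν ((L : ℤ) • y' - t') * W c t e t' x z a b)
    (fun t' x z a b => abs_dressWInner_term_le L hw hCw hδw hW hδ c t e ν y' t' x z a b) (summable_dressVWeight L hδw Cw C2 y')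
    (fun t' => by positivity) hm x z a b]
  refine tsum_congr fun t' => ?_
  have hd : dper M (fun x z a b => w e ν ((L : ℤ) • y' - t') * W c t e t' x z a b) = fun x z a b => w e ν ((L : ℤ) • y' - t') * dper M (W c t e t') x z a b := by
    funext x z a b; exact dper_const_mul M _ _ x z a b
  rw [hd, perZ_const_mul]

end Inner

/-! ## §3 The OUTER superposition and the dressed second-order family -/

section Outer

variable {N : ℕ} [NeZero N] (L : ℕ) {w : EKer (d + 1)} {Cw δw : ℝ}
  {W : Fin (d + 1) → Site (d + 1) → Fin (d + 1) → Site (d + 1) → MKer (d + 1) (Fib d)} {C2 δ : ℝ}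
  (M : Fin (d + 1) → ℕ) [∀ i, NeZero (M i)]

omit [∀ i, NeZero (M i)] in
/-- [folklore] the outer term bound: with `K₁ := Σ'_{t′} Cw·C2·e^{−(δw∕2)|t′ − L•y′|₁}` (the inner constant, `t`-free) and `m := min δ (δw∕(4N))`,
`|w c μ (L•y − t) · cwsum N (w e ν (L•y′ − ·)) (W c t e) x z a b| ≤ (Cw·K₁·e^{−(δw∕2)|t − L•y|₁}) · e^{−m′(|x − N•(L•y)|₁ + |z − N•(L•y′)|₁)}`, `m′ = min m (δw∕(4N))`
(§1, first leg, on §2's bi-localisation). -/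
theorem abs_dressWOuter_term_le (hw : ∀ c a u, |w c a u| ≤ Cw * Real.exp (-δw * l1 u)) (hCw : 0 ≤ Cw) (hδw : 0 < δw)
    (hW : VertexFamily₂ W N C2 δ) (hδ : 0 < δ) (c μ e ν : Fin (d + 1)) (y y' t x z : Site (d + 1)) (a b : Fib d) :
    |w c μ ((L : ℤ) • y - t) * cwsum N (fun t' => w e ν ((L : ℤ) • y' - t')) (W c t e) x z a b|
      ≤ (Cw * (∑' t' : Site (d + 1), Cw * C2 * Real.exp (-(δw / 2) * l1 (t' - (L : ℤ) • y'))) * Real.exp (-(δw / 2) * l1 (t - (L : ℤ) • y)))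
          * Real.exp (-(min (min δ (δw / (4 * N))) (δw / (4 * N)))
              * (l1 (x - (N : ℤ) • ((L : ℤ) • y)) + l1 (z - (N : ℤ) • ((L : ℤ) • y')))) := by
  have hC2 : 0 ≤ C2 := (hW c t e 0).nonneg (Sum.inl 0)
  have hNpos : (0 : ℝ) < N := by exact_mod_cast Nat.pos_of_ne_zero (NeZero.ne N)
  have hm : 0 < min δ (δw / (4 * N)) := lt_min hδ (by positivity)
  exact abs_recentre_fst_le L hw hCw hδw (biLoc_dressWInner L hw hCw hδw hW hδ c t e ν y') (tsum_nonneg fun t' => by positivity) hm c μ y x z a b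

/-- [folklore] **`dper_dressWOuter_apply`** — one `(c, e)` summand: `dper M (cwsum N (w c μ (L•y − ·)) (t ↦ cwsum N (w e ν (L•y′ − ·)) (W c t e))) x z a b
= Σ'_t w c μ (L•y − t) · Σ'_{t′} w e ν (L•y′ − t′) · dper M (W c t e t′) x z a b`. -/
theorem dper_dressWOuter_apply (hw : ∀ c a u, |w c a u| ≤ Cw * Real.exp (-δw * l1 u)) (hCw : 0 ≤ Cw) (hδw : 0 < δw)
    (hW : VertexFamily₂ W N C2 δ) (hδ : 0 < δ) (c μ e ν : Fin (d + 1)) (y y' x z : Site (d + 1)) (a b : Fib d) :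
    dper M (cwsum N (fun t => w c μ ((L : ℤ) • y - t)) (fun t => cwsum N (fun t' => w e ν ((L : ℤ) • y' - t')) (W c t e))) x z a b
      = ∑' t : Site (d + 1), w c μ ((L : ℤ) • y - t)
          * ∑' t' : Site (d + 1), w e ν ((L : ℤ) • y' - t') * dper M (W c t e t') x z a b := by
  have hC2 : 0 ≤ C2 := (hW c 0 e 0).nonneg (Sum.inl 0)
  have hNpos : (0 : ℝ) < N := by exact_mod_cast Nat.pos_of_ne_zero (NeZero.ne N)
  have hm' : 0 < min (min δ (δw / (4 * N))) (δw / (4 * N)) := lt_min (lt_min hδ (by positivity)) (by positivity)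
  have hform : cwsum N (fun t => w c μ ((L : ℤ) • y - t)) (fun t => cwsum N (fun t' => w e ν ((L : ℤ) • y' - t')) (W c t e))
      = fun x z a b => ∑' t : Site (d + 1), (fun t : Site (d + 1) => fun x z a b =>
          w c μ ((L : ℤ) • y - t) * cwsum N (fun t' => w e ν ((L : ℤ) • y' - t')) (W c t e) x z a b) t x z a b := by
    funext x z a b; rw [cwsum_apply]
  rw [hform, dper_tsum_family₂ M
    (T := fun t : Site (d + 1) => fun x z a b => w c μ ((L : ℤ) • y - t) * cwsum N (fun t' => w e ν ((L : ℤ) • y' - t')) (W c t e) x z a b)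
    (fun t x z a b => abs_dressWOuter_term_le L hw hCw hδw hW hδ c μ e ν y y' t x z a b)
    (summable_dressVWeight L hδw Cw _ y) (fun t => by positivity) hm' x z a b]
  refine tsum_congr fun t => ?_
  rw [dper_const_mul M, dper_dressWInner_apply L M hw hCw hδw hW hδ c t e ν y' x z a b]

/-- [folklore] **`perZ_dper_dressWOuter_apply`** — one `(c, e)` summand on the second periodisation:
`perZ M (dper M (cwsum … (cwsum … (W c · e)))) x z a b = Σ'_t w c μ (L•y − t) · Σ'_{t′} w e ν (L•y′ − t′) · perZ M (dper M (W c t e t′)) x z a b`. -/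
theorem perZ_dper_dressWOuter_apply (hw : ∀ c a u, |w c a u| ≤ Cw * Real.exp (-δw * l1 u)) (hCw : 0 ≤ Cw) (hδw : 0 < δw)
    (hW : VertexFamily₂ W N C2 δ) (hδ : 0 < δ) (c μ e ν : Fin (d + 1)) (y y' x z : Site (d + 1)) (a b : Fib d) :
    perZ M (dper M (cwsum N (fun t => w c μ ((L : ℤ) • y - t)) (fun t => cwsum N (fun t' => w e ν ((L : ℤ) • y' - t')) (W c t e)))) x z a b
      = ∑' t : Site (d + 1), w c μ ((L : ℤ) • y - t)
          * ∑' t' : Site (d + 1), w e ν ((L : ℤ) • y' - t') * perZ M (dper M (W c t e t')) x z a b := by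
  have hC2 : 0 ≤ C2 := (hW c 0 e 0).nonneg (Sum.inl 0)
  have hNpos : (0 : ℝ) < N := by exact_mod_cast Nat.pos_of_ne_zero (NeZero.ne N)
  have hm' : 0 < min (min δ (δw / (4 * N))) (δw / (4 * N)) := lt_min (lt_min hδ (by positivity)) (by positivity)
  have hform : cwsum N (fun t => w c μ ((L : ℤ) • y - t)) (fun t => cwsum N (fun t' => w e ν ((L : ℤ) • y' - t')) (W c t e))
      = fun x z a b => ∑' t : Site (d + 1), (fun t : Site (d + 1) => fun x z a b =>
          w c μ ((L : ℤ) • y - t) * cwsum N (fun t' => w e ν ((L : ℤ) • y' - t')) (W c t e) x z a b) t x z a b := by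
    funext x z a b; rw [cwsum_apply]
  rw [hform, perZ_dper_tsum_family₂ M
    (T := fun t : Site (d + 1) => fun x z a b => w c μ ((L : ℤ) • y - t) * cwsum N (fun t' => w e ν ((L : ℤ) • y' - t')) (W c t e) x z a b)
    (fun t x z a b => abs_dressWOuter_term_le L hw hCw hδw hW hδ c μ e ν y y' t x z a b)
    (summable_dressVWeight L hδw Cw _ y) (fun t => by positivity) hm' x z a b]
  refine tsum_congr fun t => ?_
  have hd : dper M (fun x z a b => w c μ ((L : ℤ) • y - t) * cwsum N (fun t' => w e ν ((L : ℤ) • y' - t')) (W c t e) x z a b)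
      = fun x z a b => w c μ ((L : ℤ) • y - t) * dper M (cwsum N (fun t' => w e ν ((L : ℤ) • y' - t')) (W c t e)) x z a b := by
    funext x z a b; exact dper_const_mul M _ _ x z a b
  rw [hd, perZ_const_mul, perZ_dper_dressWInner_apply L M hw hCw hδw hW hδ c t e ν y' x z a b]

/-- [folklore] each `(c, e)` summand's copy family is summable (for moving the finite double sum through `dper`). -/
theorem summable_translate_dressWOuter (hw : ∀ c a u, |w c a u| ≤ Cw * Real.exp (-δw * l1 u)) (hCw : 0 ≤ Cw) (hδw : 0 < δw)
    (hW : VertexFamily₂ W N C2 δ) (hδ : 0 < δ) (c μ e ν : Fin (d + 1)) (y y' x z : Site (d + 1)) (a b : Fib d) :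
    Summable fun mm : Site (d + 1) =>
      cwsum N (fun t => w c μ ((L : ℤ) • y - t)) (fun t => cwsum N (fun t' => w e ν ((L : ℤ) • y' - t')) (W c t e))
        (translate M x mm) (translate M z mm) a b := by
  have hC2 : 0 ≤ C2 := (hW c 0 e 0).nonneg (Sum.inl 0)
  have hNpos : (0 : ℝ) < N := by exact_mod_cast Nat.pos_of_ne_zero (NeZero.ne N)
  have hm' : 0 < min (min δ (δw / (4 * N))) (δw / (4 * N)) := lt_min (lt_min hδ (by positivity)) (by positivity)
  have hbl := biLoc_tsum_family₂
    (T := fun t : Site (d + 1) => fun x z a b => w c μ ((L : ℤ) • y - t) * cwsum N (fun t' => w e ν ((L : ℤ) • y' - t')) (W c t e) x z a b)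
    (fun t x z a b => abs_dressWOuter_term_le L hw hCw hδw hW hδ c μ e ν y y' t x z a b) (summable_dressVWeight L hδw Cw _ y)
  have hbl' : BiLoc (cwsum N (fun t => w c μ ((L : ℤ) • y - t)) (fun t => cwsum N (fun t' => w e ν ((L : ℤ) • y' - t')) (W c t e)))
      ((N : ℤ) • ((L : ℤ) • y)) ((N : ℤ) • ((L : ℤ) • y')) _ _ := fun x' z' a' b' => by rw [cwsum_apply]; exact hbl x' z' a' b'
  exact summable_dper M hbl' (tsum_nonneg fun t => by positivity) hm' x z a b

/-- [folklore] each `(c, e)` summand's `dper` is summable along the second-argument copies (for moving the finite double sum through `perZ`). -/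
theorem summable_translate_dper_dressWOuter (hw : ∀ c a u, |w c a u| ≤ Cw * Real.exp (-δw * l1 u)) (hCw : 0 ≤ Cw) (hδw : 0 < δw)
    (hW : VertexFamily₂ W N C2 δ) (hδ : 0 < δ) (c μ e ν : Fin (d + 1)) (y y' x z : Site (d + 1)) (a b : Fib d) :
    Summable fun mm : Site (d + 1) =>
      dper M (cwsum N (fun t => w c μ ((L : ℤ) • y - t)) (fun t => cwsum N (fun t' => w e ν ((L : ℤ) • y' - t')) (W c t e)))
        x (translate M z mm) a b := by
  have hC2 : 0 ≤ C2 := (hW c 0 e 0).nonneg (Sum.inl 0)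
  have hNpos : (0 : ℝ) < N := by exact_mod_cast Nat.pos_of_ne_zero (NeZero.ne N)
  have hm' : 0 < min (min δ (δw / (4 * N))) (δw / (4 * N)) := lt_min (lt_min hδ (by positivity)) (by positivity)
  have h := summable_translate_dper_tsum_family₂ M
    (T := fun t : Site (d + 1) => fun x z a b => w c μ ((L : ℤ) • y - t) * cwsum N (fun t' => w e ν ((L : ℤ) • y' - t')) (W c t e) x z a b)
    (fun t x z a b => abs_dressWOuter_term_le L hw hCw hδw hW hδ c μ e ν y y' t x z a b)
    (summable_dressVWeight L hδw Cw _ y) (fun t => by positivity) hm' x z a b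
  refine h.congr fun mm => ?_
  congr 1
  funext x' z' a' b'
  rw [cwsum_apply]

/-- [folklore] **`dper_dressW_apply` — THE DIAGONAL PERIODISATION OF THE DRESSED SECOND-ORDER FAMILY**:
`dper M (dressW N L w W μ y ν y′) x z a b = Σ_c Σ_e Σ'_t w c μ (L•y − t) · Σ'_{t′} w e ν (L•y′ − t′) · dper M (W c t e t′) x z a b`. -/
theorem dper_dressW_apply (hw : ∀ c a u, |w c a u| ≤ Cw * Real.exp (-δw * l1 u)) (hCw : 0 ≤ Cw) (hδw : 0 < δw)
    (hW : VertexFamily₂ W N C2 δ) (hδ : 0 < δ) (μ : Fin (d + 1)) (y : Site (d + 1)) (ν : Fin (d + 1)) (y' x z : Site (d + 1)) (a b : Fib d) :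
    dper M (dressW N L w W μ y ν y') x z a b
      = ∑ c : Fin (d + 1), ∑ e : Fin (d + 1), ∑' t : Site (d + 1), w c μ ((L : ℤ) • y - t)
          * ∑' t' : Site (d + 1), w e ν ((L : ℤ) • y' - t') * dper M (W c t e t') x z a b := by
  rw [dressW_eq_sum, dper_apply]
  simp only [Finset.sum_apply]
  rw [Summable.tsum_finsetSum fun c _ => summable_sum fun e _ => summable_translate_dressWOuter L M hw hCw hδw hW hδ c μ e ν y y' x z a b]
  refine Finset.sum_congr rfl fun c _ => ?_
  rw [Summable.tsum_finsetSum fun e _ => summable_translate_dressWOuter L M hw hCw hδw hW hδ c μ e ν y y' x z a b]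
  refine Finset.sum_congr rfl fun e _ => ?_
  rw [← dper_apply, dper_dressWOuter_apply L M hw hCw hδw hW hδ c μ e ν y y' x z a b]

/-- [folklore] **`perZ_dper_dressW_apply` — THE SECOND PERIODISATION PASSES THROUGH TOO**:
`perZ M (dper M (dressW N L w W μ y ν y′)) x z a b = Σ_c Σ_e Σ'_t w c μ (L•y − t) · Σ'_{t′} w e ν (L•y′ − t′) · perZ M (dper M (W c t e t′)) x z a b`. -/
theorem perZ_dper_dressW_apply (hw : ∀ c a u, |w c a u| ≤ Cw * Real.exp (-δw * l1 u)) (hCw : 0 ≤ Cw) (hδw : 0 < δw)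
    (hW : VertexFamily₂ W N C2 δ) (hδ : 0 < δ) (μ : Fin (d + 1)) (y : Site (d + 1)) (ν : Fin (d + 1)) (y' x z : Site (d + 1)) (a b : Fib d) :
    perZ M (dper M (dressW N L w W μ y ν y')) x z a b
      = ∑ c : Fin (d + 1), ∑ e : Fin (d + 1), ∑' t : Site (d + 1), w c μ ((L : ℤ) • y - t)
          * ∑' t' : Site (d + 1), w e ν ((L : ℤ) • y' - t') * perZ M (dper M (W c t e t')) x z a b := by
  -- `dper` of the finite double sum, copy by copy
  have hsplit : ∀ zz : Site (d + 1), dper M (dressW N L w W μ y ν y') x zz a b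
      = ∑ c : Fin (d + 1), ∑ e : Fin (d + 1),
          dper M (cwsum N (fun t => w c μ ((L : ℤ) • y - t)) (fun t => cwsum N (fun t' => w e ν ((L : ℤ) • y' - t')) (W c t e))) x zz a b := by
    intro zz
    rw [dressW_eq_sum, dper_apply]
    simp only [Finset.sum_apply]
    rw [Summable.tsum_finsetSum fun c _ => summable_sum fun e _ => summable_translate_dressWOuter L M hw hCw hδw hW hδ c μ e ν y y' x zz a b]
    refine Finset.sum_congr rfl fun c _ => ?_
    rw [Summable.tsum_finsetSum fun e _ => summable_translate_dressWOuter L M hw hCw hδw hW hδ c μ e ν y y' x zz a b]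
    refine Finset.sum_congr rfl fun e _ => ?_
    rw [← dper_apply]
  rw [perZ_apply]
  simp only [hsplit]
  rw [Summable.tsum_finsetSum fun c _ => summable_sum fun e _ => summable_translate_dper_dressWOuter L M hw hCw hδw hW hδ c μ e ν y y' x z a b]
  refine Finset.sum_congr rfl fun c _ => ?_
  rw [Summable.tsum_finsetSum fun e _ => summable_translate_dper_dressWOuter L M hw hCw hδw hW hδ c μ e ν y y' x z a b]
  refine Finset.sum_congr rfl fun e _ => ?_
  rw [← perZ_apply, perZ_dper_dressWOuter_apply L M hw hCw hδw hW hδ c μ e ν y y' x z a b]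

/-- [folklore] **`perF_dper_dressW` — ON THE TORUS**:
`perF M (dper M (dressW N L w W μ y ν y′)) p q = Σ_c Σ_e Σ'_t w c μ (L•y − t) · Σ'_{t′} w e ν (L•y′ − t′) · perF M (dper M (W c t e t′)) p q`. -/
theorem perF_dper_dressW (hw : ∀ c a u, |w c a u| ≤ Cw * Real.exp (-δw * l1 u)) (hCw : 0 ≤ Cw) (hδw : 0 < δw)
    (hW : VertexFamily₂ W N C2 δ) (hδ : 0 < δ) (μ : Fin (d + 1)) (y : Site (d + 1)) (ν : Fin (d + 1)) (y' : Site (d + 1)) (p q : Idx M (Fib d)) :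
    perF M (dper M (dressW N L w W μ y ν y')) p q
      = ∑ c : Fin (d + 1), ∑ e : Fin (d + 1), ∑' t : Site (d + 1), w c μ ((L : ℤ) • y - t)
          * ∑' t' : Site (d + 1), w e ν ((L : ℤ) • y' - t') * perF M (dper M (W c t e t')) p q := by
  simp only [perF_apply]
  exact perZ_dper_dressW_apply L M hw hCw hδw hW hδ μ y ν y' _ _ _ _

end Outer

end Summit.QuantumFields.BalabanUV.Beta.FP.KernelStepDressingPeriodisedW

end
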